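import Literature.NumberTheory.EllipticCurves.Wuthrich2014.ThreeAdicImageSupersingularProofs
import HarnessLib

/-!
# Inertia at `3` acting on `E[3]` and `E[9]`: valuations give divisibility, a cardinality gap gives
# a first-order element non-scalar on `E[9]` (curve-independent; cell `b2b-bsdres`, team n1011,
# row T-b9 'tame tower at `3`' — generic layer, seat p02; part 1 of 2)

HONEST FRAMING (cell `b2b-bsdres`, run/shared/lean/b2b/bsd-rank1-residual/, verbatim in every
file): the goal of the cell is to DELETE the COMBINATION-SHAPED residual classes of the
Birch–Swinnerton-Dyer formula for ALL analytic-rank `≤ 1` elliptic curves over `ℚ` — "full BSD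
formula for every rank `≤ 1` curve in class `C`" assembled STRICTLY from published theorems — so
that the rank-`≤ 1` remainder becomes exactly the CONSTRUCTION-SHAPED classes, which are TYPED
(missing-input `Prop`s), NOT attempted. This is not "finishing BSD". Research route; theorems
only (no definition, no named fact); nothing is booked by this file; no label changes.

## What this file proves (our lemmas; the template is the good-supersingular proof of Wuthrich
2014 Lemma 20, `Literature/…/Wuthrich2014/ThreeAdicImageSupersingularProofs.lean` §§2–3, whose
hypotheses "`3 ∤ Δ`, `3 ∣ a₃`" are replaced by bare valuation / cardinality data)

Let `E = W/ℚ` be an elliptic curve, `𝔓` the prime of `\bar ℤ` of the place `v` over `3`,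
`I = I_𝔓 ≤ Γ_ℚ`, `e_n := #ρ̄_{E,n}(I)`.

* §1 `dvd_card_inertia_map_galoisRepTorsion_of_valuation` (`_X`, `_Y` for the coordinates of a
  torsion point) — VALUATIONS ⟹ DIVISIBILITY: if some non-zero `z ∈ ℚ(E[n])` satisfies
  `v(z)^d · v(3)^a = v(3)^b` with `d` coprime to `a − b`, then `d ∣ e_n` (Hilbert theory:
  `e(P_L ∣ 3) = #I(P_L) = #I_𝔓|_L = e_n` for `L = ℚ(E[n])`, Serre *Local Fields* I §7).
* §2 `exists_mem_fixing_three_not_scalar_nine_of_lt_card` — COUNTING, for any `H ≤ Γ_ℚ`: if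
  `3 · #ρ̄₃(H) < #ρ̄₉(H)`, some `s ∈ H` fixes `E[3]` pointwise and is NOT a scalar `(1 + 3m)·` on
  `E[9]` (the kernel of `ρ̄₉(H) ↠ ρ̄₃(H)` has more than `3` elements —
  `card_map_nine_eq_card_map_inf_ker_mul_card_map_three` — of which at most `3` are such
  scalars — `card_map_inf_ker_le_three_of_forall_scalar`).

Part 2 (`GaloisImage/ThreeAdicTowerInertiaCriterion.lean`): `9 ∤ #ρ̄₃(H)`, so `27 ∣ #ρ̄₉(H)`
suffices; and with `ρ̄_{E,3}` onto, the `3`-adic TOWER (Serre IV-23 with the first-order witness,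
`Kato2004/TorsionNonscalarWitnessProofs.lean`).  Nothing here depends on the reduction type of `E`
at `3`; use (row T-b9, seat p14): Kodaira III / III* at `3`.

References: [SerreLocalFields1979] J.-P. Serre, *Local Fields*, Ch. I §7 Prop. 20–22;
[Serre1972] J.-P. Serre, Invent. Math. 15 (1972), §1; [Elkies2006] N. D. Elkies,
arXiv:math/0612734 (the exotic `3`-adic images: `ρ̄₉(Γ) ∩ ker(→ GL₂(𝔽₃))` = three scalars).
-/

noncomputable section

open scoped Classical NumberField Pointwise
open Field IsDedekindDomain WeierstrassCurve

-- As in `Wuthrich2014/ThreeAdicImageSupersingularProofs`: pin `Algebra ℚ ℚ̄` to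
-- `AlgebraicClosure.instAlgebra` (the instance under which `absoluteGaloisGroup ℚ`,
-- `divisionField`, `absIntegers` are stated); `Subsingleton (Algebra ℚ _)`, nothing is overridden
-- in substance.
attribute [local instance 1001] IntermediateField.algebra'
attribute [local instance 1002] AlgebraicClosure.instAlgebra

namespace Summit.BirchSwinnertonDyer.Rank1Residual.GaloisImage

open Literature.NumberTheory.EllipticCurves Literature.NumberTheory.GaloisRepresentations
  Rat.HeightOneSpectrum

/-! ### §1 Valuations of elements of the division field ⟹ divisibility of `#ρ̄ₙ(I_𝔓)` -/

section Valuation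

variable {W : WeierstrassCurve ℚ} [W.IsElliptic]

/-- `3 ∈ v` and `3 ∉ v²` for the place `v` of `ℚ` at `3` (`v = (3)` in `𝓞 ℚ ≅ ℤ`). [folklore] -/
private theorem three_mem_and_not_mem_sq' {v : HeightOneSpectrum (𝓞 ℚ)}
    (hv : (primesEquiv v : ℕ) = 3) :
    ((3 : ℕ) : 𝓞 ℚ) ∈ v.asIdeal ∧ ((3 : ℕ) : 𝓞 ℚ) ∉ v.asIdeal ^ 2 := by
  have hgen : natGenerator v = 3 := hv
  set e := Rat.IsIntegralClosure.intEquiv (𝓞 ℚ) with he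
  refine ⟨?_, ?_⟩
  · have h := (natGenerator_dvd_iff v).mp (dvd_refl (natGenerator v))
    rw [hgen] at h
    rwa [← map_natCast e, Ideal.apply_mem_of_equiv_iff] at h
  · intro h3
    have h' : e ((3 : ℕ) : 𝓞 ℚ) ∈ (v.asIdeal ^ 2).map e := Ideal.mem_map_of_mem _ h3
    rw [Ideal.map_pow, ← span_natGenerator, hgen, Ideal.span_singleton_pow, map_natCast,
      Ideal.mem_span_singleton] at h'
    norm_num at h'

/-- **Valuation ⟹ ramification divisibility.**  Let `n ≥ 1`, `L = ℚ(E[n])`, `𝔓` the prime of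
`\bar ℤ` of the place `v` over `3`, `I_𝔓 ≤ Γ_ℚ` its inertia group.  If a non-zero `z ∈ L`
satisfies `v(z)^d · v(3)^a = v(3)^b` with `d` coprime to `a − b`, then `d ∣ #ρ̄_{E,n}(I_𝔓)`:
indeed `#ρ̄_{E,n}(I_𝔓) = #I_𝔓|_L = #I(P_L) = e(P_L ∣ 3)` (the kernel of `Γ_ℚ → Gal(L/ℚ)` is the
fixer of `E[n]`; Hilbert theory), and reading the identity in the `P_L`-adic valuation gives
`d · ord(z) = (a − b) · e`. [cite: SerreLocalFields1979, Ch. I §7 Cor. to Prop. 21 and Prop. 22(b)] -/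
theorem dvd_card_inertia_map_galoisRepTorsion_of_valuation {n : ℕ} [NeZero n]
    {v : HeightOneSpectrum (𝓞 ℚ)} (hv : (primesEquiv v : ℕ) = 3)
    {𝔓 : Ideal (absIntegers (𝓞 ℚ) ℚ)}
    (hmem : ∀ x : absIntegers (𝓞 ℚ) ℚ, x ∈ 𝔓 ↔ (x : AlgebraicClosure ℚ) ∈ (placeOver 3).nonunits)
    (h𝔓 : 𝔓 ∈ v.primesAbove)
    {z : AlgebraicClosure ℚ} (hzL : z ∈ W.divisionField n) (hz0 : z ≠ 0) {d a b : ℕ}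
    (hval : (placeOver 3).valuation z ^ d * (placeOver 3).valuation 3 ^ a =
      (placeOver 3).valuation 3 ^ b)
    (hcop : IsCoprime (d : ℤ) ((a : ℤ) - b)) :
    d ∣ Nat.card ((𝔓.inertia (absoluteGaloisGroup ℚ)).map (galoisRepTorsion W n)) := by
  haveI : Fact (Nat.Prime 3) := ⟨Nat.prime_three⟩
  haveI : 𝔓.IsPrime := h𝔓.1
  haveI h𝔓max : 𝔓.IsMaximal := HeightOneSpectrum.isMaximal_of_mem_primesAbove h𝔓
  set L := W.divisionField n with hL
  haveI : IsGalois ℚ L := inferInstance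
  haveI hDD : IsDedekindDomain (integralClosure (𝓞 ℚ) L) :=
    integralClosure.isDedekindDomain (𝓞 ℚ) ℚ L
  haveI : IsFractionRing (integralClosure (𝓞 ℚ) L) L :=
    integralClosure.isFractionRing_of_finite_extension ℚ L
  set PL := 𝔓.comap (L.integralClosureToAbsIntegers (𝓞 ℚ)) with hPL
  haveI hPLmax : PL.IsMaximal := isMaximal_comap_integralClosureToAbsIntegers (𝓞 ℚ) 𝔓 L
  obtain ⟨h3v, h3v2⟩ := three_mem_and_not_mem_sq' hv
  -- `3 ∈ P_L`, so `P_L ≠ 0`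
  have h3PL : algebraMap (𝓞 ℚ) (integralClosure (𝓞 ℚ) L) ((3 : ℕ) : 𝓞 ℚ) ∈ PL := by
    have hunder : PL.under (𝓞 ℚ) = v.asIdeal := by
      rw [hPL, under_comap_integralClosureToAbsIntegers, ← h𝔓.2.over]
    have : ((3 : ℕ) : 𝓞 ℚ) ∈ PL.under (𝓞 ℚ) := by rw [hunder]; exact h3v
    rwa [Ideal.under_def, Ideal.mem_comap] at this
  have hPL0 : PL ≠ ⊥ := by
    intro h0
    rw [h0, Ideal.mem_bot] at h3PL
    have hinj : Function.Injective (algebraMap (𝓞 ℚ) (integralClosure (𝓞 ℚ) L)) :=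
      (faithfulSMul_iff_algebraMap_injective _ _).mp
        (faithfulSMul_integralClosure (𝓞 ℚ) (K := ℚ) (L := L))
    have h30 : ((3 : ℕ) : 𝓞 ℚ) = 0 := hinj (h3PL.trans (map_zero _).symm)
    apply h3v2
    rw [h30]
    exact Submodule.zero_mem _
  set w : HeightOneSpectrum (integralClosure (𝓞 ℚ) L) := ⟨PL, hPLmax.isPrime, hPL0⟩ with hw
  -- Hilbert theory: `ord_{P_L}(3) = #I(P_L) = #I_𝔓|_L`
  have hord := ord_algebraMap_eq_card_inertia_of_mem_primesAbove h𝔓 L h3v h3v2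
  rw [map_natCast, Ideal.ramificationSubgroup_zero,
    inertia_comap_eq_map_absRestrictNormalHom (R := 𝓞 ℚ) 𝔓 L] at hord
  -- the restriction to `L` and `ρ̄_{E,n}` have the same kernel, hence images of the same size
  set I := 𝔓.inertia (absoluteGaloisGroup ℚ) with hI
  have hker : (absRestrictNormalHom L).ker = (galoisRepTorsion W n).ker := by
    ext σ
    simp only [MonoidHom.mem_ker]
    exact (W.absRestrictNormalHom_divisionField_eq_one_iff n σ).trans
      (galoisRepTorsion_eq_one_iff' W n σ).symm
  have hcardA : Nat.card (I.map (absRestrictNormalHom L)) =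
      Nat.card (I.map (galoisRepTorsion W n)) := by
    rw [← Subgroup.relIndex_ker, ← Subgroup.relIndex_ker, hker]
  set e : ℕ := Nat.card (I.map (galoisRepTorsion W n)) with he
  rw [hcardA] at hord
  -- `w(3) = exp(-e)`
  have hw3 : w.valuation L (3 : L) = WithZero.exp (-(e : ℤ)) := by
    have h3alg : (3 : L) = algebraMap (integralClosure (𝓞 ℚ) L) L 3 := by rw [map_ofNat]
    rw [h3alg, HeightOneSpectrum.valuation_of_algebraMap,
      ← WeierstrassCurve.OggWild.ord_eq_natCast_iff_intValuation_eq w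
        (3 : integralClosure (𝓞 ℚ) L) e]
    have h3map : algebraMap (𝓞 ℚ) (integralClosure (𝓞 ℚ) L) ((3 : ℕ) : 𝓞 ℚ) = 3 := by
      rw [map_natCast]; rfl
    rw [← h3map]
    exact hord
  -- `z ∈ L`
  set zL : L := ⟨z, hzL⟩ with hzLdef
  have hzL0 : zL ≠ 0 := by
    intro h0
    apply hz0
    simpa [hzLdef] using congrArg (fun t : L ↦ (t : AlgebraicClosure ℚ)) h0
  have h3L0 : (3 : L) ≠ 0 := three_ne_zero
  -- transfer `v(z^d · 3^a · (3^b)⁻¹) = 1` to `w`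
  set t : L := zL ^ d * 3 ^ a * (3 ^ b)⁻¹ with ht
  have ht0 : t ≠ 0 :=
    mul_ne_zero (mul_ne_zero (pow_ne_zero _ hzL0) (pow_ne_zero _ h3L0))
      (inv_ne_zero (pow_ne_zero _ h3L0))
  have hv30 : (placeOver 3).valuation ((3 : L) : AlgebraicClosure ℚ) ≠ 0 :=
    (Valuation.ne_zero_iff _).mpr (by exact_mod_cast (three_ne_zero : (3 : AlgebraicClosure ℚ) ≠ 0))
  have hval' : (placeOver 3).valuation (zL : AlgebraicClosure ℚ) ^ d *
      (placeOver 3).valuation ((3 : L) : AlgebraicClosure ℚ) ^ a =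
        (placeOver 3).valuation ((3 : L) : AlgebraicClosure ℚ) ^ b := by
    exact_mod_cast hval
  have hvt : (placeOver 3).valuation ((t : L) : AlgebraicClosure ℚ) = 1 := by
    rw [ht]
    push_cast
    rw [map_mul, map_mul, map_inv₀, map_pow, map_pow, map_pow, hval',
      mul_inv_cancel₀ (pow_ne_zero _ hv30)]
  have hwt := (valuation_placeOver_eq_one_iff_valuation_eq_one hmem w rfl ht0).mp hvt
  rw [ht, map_mul, map_mul, map_inv₀, map_pow, map_pow, map_pow, hw3] at hwt
  -- `w(zL) = exp k`, so `d k - a e = - b e`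
  have hwz0 : w.valuation L zL ≠ 0 := (Valuation.ne_zero_iff _).mpr hzL0
  obtain ⟨k, hk⟩ : ∃ k : ℤ, w.valuation L zL = WithZero.exp k :=
    ⟨WithZero.log (w.valuation L zL), (WithZero.exp_log hwz0).symm⟩
  have hexp0 : (WithZero.exp (-(e : ℤ)) : WithZero (Multiplicative ℤ)) ^ b ≠ 0 :=
    pow_ne_zero _ WithZero.coe_ne_zero
  rw [mul_inv_eq_one₀ hexp0, hk, ← WithZero.exp_nsmul, ← WithZero.exp_nsmul, ← WithZero.exp_nsmul,
    ← WithZero.exp_add, WithZero.exp_inj] at hwt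
  simp only [nsmul_eq_mul] at hwt
  -- `d k = (a - b) e`, and `d` is coprime to `a - b`
  have hdk : (d : ℤ) * k = ((a : ℤ) - b) * e := by linarith
  have hdvd : (d : ℤ) ∣ ((a : ℤ) - b) * e := ⟨k, by rw [← hdk]⟩
  have hdvd' : (d : ℤ) ∣ (e : ℤ) := hcop.dvd_of_dvd_mul_left hdvd
  exact_mod_cast hdvd'

/-- §1 for the ABSCISSA of a torsion point: if `Q = (x, y) ∈ E[n]` and
`v(x)^d · v(3)^a = v(3)^b` with `d` coprime to `a − b`, then `d ∣ #ρ̄_{E,n}(I_𝔓)`.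
[cite: SerreLocalFields1979, Ch. I §7 Cor. to Prop. 21 and Prop. 22(b)] -/
theorem dvd_card_inertia_map_galoisRepTorsion_of_valuation_X {n : ℕ} [NeZero n]
    {v : HeightOneSpectrum (𝓞 ℚ)} (hv : (primesEquiv v : ℕ) = 3)
    {𝔓 : Ideal (absIntegers (𝓞 ℚ) ℚ)}
    (hmem : ∀ x : absIntegers (𝓞 ℚ) ℚ, x ∈ 𝔓 ↔ (x : AlgebraicClosure ℚ) ∈ (placeOver 3).nonunits)
    (h𝔓 : 𝔓 ∈ v.primesAbove)
    {Q : W.geomPoints} (hQ : Q ∈ geomTorsion W n) {x y : AlgebraicClosure ℚ}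
    {h : (W.map (algebraMap ℚ (AlgebraicClosure ℚ))).toAffine.Nonsingular x y}
    (hQxy : Q = .some (x := x) (y := y) h) (hx0 : x ≠ 0) {d a b : ℕ}
    (hval : (placeOver 3).valuation x ^ d * (placeOver 3).valuation 3 ^ a =
      (placeOver 3).valuation 3 ^ b)
    (hcop : IsCoprime (d : ℤ) ((a : ℤ) - b)) :
    d ∣ Nat.card ((𝔓.inertia (absoluteGaloisGroup ℚ)).map (galoisRepTorsion W n)) := by
  obtain ⟨hxL, -⟩ := W.mem_divisionField_of_eq_some (n := n) (T := ⟨Q, hQ⟩) hQxy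
  exact dvd_card_inertia_map_galoisRepTorsion_of_valuation hv hmem h𝔓 hxL hx0 hval hcop

/-- §1 for the ORDINATE of a torsion point: if `Q = (x, y) ∈ E[n]` and
`v(y)^d · v(3)^a = v(3)^b` with `d` coprime to `a − b`, then `d ∣ #ρ̄_{E,n}(I_𝔓)`.
[cite: SerreLocalFields1979, Ch. I §7 Cor. to Prop. 21 and Prop. 22(b)] -/
theorem dvd_card_inertia_map_galoisRepTorsion_of_valuation_Y {n : ℕ} [NeZero n]
    {v : HeightOneSpectrum (𝓞 ℚ)} (hv : (primesEquiv v : ℕ) = 3)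
    {𝔓 : Ideal (absIntegers (𝓞 ℚ) ℚ)}
    (hmem : ∀ x : absIntegers (𝓞 ℚ) ℚ, x ∈ 𝔓 ↔ (x : AlgebraicClosure ℚ) ∈ (placeOver 3).nonunits)
    (h𝔓 : 𝔓 ∈ v.primesAbove)
    {Q : W.geomPoints} (hQ : Q ∈ geomTorsion W n) {x y : AlgebraicClosure ℚ}
    {h : (W.map (algebraMap ℚ (AlgebraicClosure ℚ))).toAffine.Nonsingular x y}
    (hQxy : Q = .some (x := x) (y := y) h) (hy0 : y ≠ 0) {d a b : ℕ}
    (hval : (placeOver 3).valuation y ^ d * (placeOver 3).valuation 3 ^ a =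
      (placeOver 3).valuation 3 ^ b)
    (hcop : IsCoprime (d : ℤ) ((a : ℤ) - b)) :
    d ∣ Nat.card ((𝔓.inertia (absoluteGaloisGroup ℚ)).map (galoisRepTorsion W n)) := by
  obtain ⟨-, hyL⟩ := W.mem_divisionField_of_eq_some (n := n) (T := ⟨Q, hQ⟩) hQxy
  exact dvd_card_inertia_map_galoisRepTorsion_of_valuation hv hmem h𝔓 hyL hy0 hval hcop

end Valuation

/-! ### §2 Counting: a kernel element of `ρ̄₉(I) ↠ ρ̄₃(I)` that is not a scalar `(1+3m)·` -/

section Counting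

variable {W : WeierstrassCurve ℚ} [W.IsElliptic]

omit [W.IsElliptic] in
/-- `ker ρ̄_{E,9} ≤ ker ρ̄_{E,3}` (`E[3] ⊆ E[9]`). [folklore] -/
theorem ker_galoisRepTorsion_nine_le_ker_three :
    (galoisRepTorsion W 9).ker ≤ (galoisRepTorsion W 3).ker := by
  intro σ hσ
  rw [MonoidHom.mem_ker, galoisRepTorsion_eq_one_iff'] at hσ
  rw [MonoidHom.mem_ker, galoisRepTorsion_eq_one_iff']
  intro P
  have hP9 : (P : W.geomPoints) ∈ geomTorsion W 9 := by
    have h3 := (Submodule.mem_torsionBy_iff _ _).mp P.2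
    refine (Submodule.mem_torsionBy_iff _ _).mpr ?_
    rw [show (9 : ℤ) = 3 * 3 by norm_num, mul_smul, h3, smul_zero]
  have h : σ • (P : W.geomPoints) = P := congrArg Subtype.val (hσ ⟨P, hP9⟩)
  exact Subtype.ext h

omit [W.IsElliptic] in
/-- **`#ρ̄₉(H) = #ρ̄₉(H ∩ ker ρ̄₃) · #ρ̄₃(H)`** for every `H ≤ Γ_ℚ`: the image of `H ∩ ker ρ̄₃`
under `ρ̄₉` is the kernel of `ρ̄₉(H) ↠ ρ̄₃(H)`. [folklore] -/
theorem card_map_nine_eq_card_map_inf_ker_mul_card_map_three (H : Subgroup (absoluteGaloisGroup ℚ)) :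
    Nat.card ((((galoisRepTorsion W 3).ker ⊓ H)).map (galoisRepTorsion W 9)) *
        Nat.card (H.map (galoisRepTorsion W 3)) =
      Nat.card (H.map (galoisRepTorsion W 9)) := by
  rw [← Subgroup.relIndex_ker, ← Subgroup.relIndex_ker, ← Subgroup.relIndex_ker,
    Subgroup.relIndex_inf_mul_relIndex, inf_eq_left.mpr ker_galoisRepTorsion_nine_le_ker_three]

omit [W.IsElliptic] in
/-- If `ρ̄(s t)` and `ρ̄(t)` act on `E[9]` as scalars `≡ 1 (mod 3)`, so does `ρ̄(s)`
(`(1+3m')³ ≡ 1 (mod 9)`). [folklore] -/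
theorem scalar_nine_of_scalar_mul_of_scalar {s t : absoluteGaloisGroup ℚ}
    (hst : ∃ m : ℕ, ∀ Q ∈ geomTorsion W 9, (s * t) • Q = (1 + 3 * m) • Q)
    (ht : ∃ m : ℕ, ∀ Q ∈ geomTorsion W 9, t • Q = (1 + 3 * m) • Q) :
    ∃ m : ℕ, ∀ Q ∈ geomTorsion W 9, s • Q = (1 + 3 * m) • Q := by
  obtain ⟨m, hm⟩ := hst
  obtain ⟨m', hm'⟩ := ht
  refine ⟨m + 2 * m' + 6 * m * m' + 3 * m' ^ 2 + 9 * m * m' ^ 2, fun Q hQ ↦ ?_⟩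
  have hQ' : Q ∈ AddSubgroup.torsionBy W.geomPoints ((9 : ℕ) : ℤ) := by exact_mod_cast hQ
  have h9Q : (9 : ℕ) • Q = 0 := AddSubgroup.torsionBy.nsmul_iff.mp hQ'
  have hsQ : (9 : ℕ) • (s • Q) = 0 := by rw [smul_comm, h9Q, smul_zero]
  have h1 : (1 + 3 * m') • (s • Q) = (1 + 3 * m) • Q := by
    rw [← smul_comm s, ← hm' Q hQ, ← mul_smul]
    exact hm Q hQ
  have h2 : ((1 + 3 * m') ^ 2 * (1 + 3 * m')) • (s • Q) =
      ((1 + 3 * m') ^ 2 * (1 + 3 * m)) • Q := by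
    rw [mul_smul, mul_smul, h1]
  have hcube : ((1 + 3 * m') ^ 2 * (1 + 3 * m')) • (s • Q) = s • Q := by
    have : (1 + 3 * m') ^ 2 * (1 + 3 * m') = 1 + 9 * (m' + 3 * m' ^ 2 + 3 * m' ^ 3) := by ring
    rw [this, add_smul, one_smul, mul_smul, smul_comm (9 : ℕ), hsQ, smul_zero, add_zero]
  rw [hcube] at h2
  rw [h2]
  congr 1
  ring

omit [W.IsElliptic] in
/-- **The scalars `(1 + 3m)·` among `ρ̄₉(H ∩ ker ρ̄₃)` are at most `3`**: if every element of
`H ∩ ker ρ̄_{E,3}` acts on `E[9]` as a scalar `≡ 1 (mod 3)`, then `#ρ̄₉(H ∩ ker ρ̄₃) ≤ 3` (an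
element of the image acting as `(1 + 3m)·` is determined by `m mod 3`, since `E[9]` is
`9`-torsion). [folklore] -/
theorem card_map_inf_ker_le_three_of_forall_scalar (H : Subgroup (absoluteGaloisGroup ℚ))
    (hall : ∀ s ∈ H, (∀ P ∈ geomTorsion W 3, s • P = P) →
      ∃ m : ℕ, ∀ Q ∈ geomTorsion W 9, s • Q = (1 + 3 * m) • Q) :
    Nat.card ((((galoisRepTorsion W 3).ker ⊓ H)).map (galoisRepTorsion W 9)) ≤ 3 := by
  set C := (((galoisRepTorsion W 3).ker ⊓ H)).map (galoisRepTorsion W 9) with hC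
  have hsc : ∀ φ : C, ∃ m : ℕ, ∀ Q : geomTorsion W 9,
      ((φ : Multiplicative (AddAut (geomTorsion W 9))).toAdd Q : W.geomPoints) =
        (1 + 3 * m) • (Q : W.geomPoints) := by
    intro φ
    obtain ⟨sφ, hsφ, hφ⟩ := Subgroup.mem_map.mp φ.2
    have hsH : sφ ∈ H := hsφ.2
    have hs3 : ∀ P ∈ geomTorsion W 3, sφ • P = P := by
      intro P hP
      have := (galoisRepTorsion_eq_one_iff' W 3 sφ).mp hsφ.1 ⟨P, hP⟩
      exact congrArg Subtype.val this
    obtain ⟨m, hm⟩ := hall sφ hsH hs3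
    refine ⟨m, fun Q ↦ ?_⟩
    rw [← hφ, galoisRepTorsion_apply, AddSubgroup.torsionBy.coe_smul]
    exact hm Q Q.2
  choose mφ hmφ using hsc
  have hinj : Function.Injective fun φ : C ↦ (mφ φ : ZMod 3) := by
    intro φ ψ hφψ
    have hmod : mφ φ % 3 = mφ ψ % 3 := (ZMod.natCast_eq_natCast_iff' _ _ 3).mp hφψ
    apply Subtype.ext
    refine Multiplicative.toAdd.injective (AddEquiv.ext fun Q ↦ Subtype.ext ?_)
    have hQ9 : (Q : W.geomPoints) ∈ AddSubgroup.torsionBy W.geomPoints ((9 : ℕ) : ℤ) := by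
      exact_mod_cast Q.2
    have key : ∀ m : ℕ, (1 + 3 * m) • (Q : W.geomPoints) =
        ((1 + 3 * m) % 9) • (Q : W.geomPoints) :=
      fun m ↦ AddSubgroup.torsionBy.mod_self_nsmul' _ hQ9
    rw [hmφ φ Q, hmφ ψ Q, key, key (mφ ψ)]
    congr 1
    omega
  have hle : Nat.card C ≤ Nat.card (ZMod 3) := Nat.card_le_card_of_injective _ hinj
  rwa [Nat.card_zmod] at hle

omit [W.IsElliptic] in
/-- **COUNTING CRITERION.**  For any `H ≤ Γ_ℚ` (in practice an inertia group at `3`): if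
`3 · #ρ̄_{E,3}(H) < #ρ̄_{E,9}(H)`, then some `s ∈ H` fixes `E[3]` pointwise and is NOT a scalar
`(1 + 3m)·` on `E[9]` — the kernel of `ρ̄₉(H) ↠ ρ̄₃(H)` has more than `3` elements, of which
at most `3` are such scalars.  (At a good supersingular `3` with `H = I_𝔓`: `#ρ̄₃ = 8`,
`72 ∣ #ρ̄₉` — `Wuthrich2014/ThreeAdicImageSupersingularProofs`,
`exists_mem_inertia_fixing_three_not_scalar_nine`.) [folklore] -/
theorem exists_mem_fixing_three_not_scalar_nine_of_lt_card (H : Subgroup (absoluteGaloisGroup ℚ))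
    (hlt : 3 * Nat.card (H.map (galoisRepTorsion W 3)) < Nat.card (H.map (galoisRepTorsion W 9))) :
    ∃ s ∈ H, (∀ P ∈ geomTorsion W 3, s • P = P) ∧
      ¬ ∃ m : ℕ, ∀ Q ∈ geomTorsion W 9, s • Q = (1 + 3 * m) • Q := by
  by_contra hnone
  push Not at hnone
  have hC := card_map_inf_ker_le_three_of_forall_scalar (W := W) H hnone
  have hmul := card_map_nine_eq_card_map_inf_ker_mul_card_map_three (W := W) H
  have : Nat.card (H.map (galoisRepTorsion W 9)) ≤ 3 * Nat.card (H.map (galoisRepTorsion W 3)) := by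
    rw [← hmul]
    exact Nat.mul_le_mul_right _ hC
  omega

end Counting

end Summit.BirchSwinnertonDyer.Rank1Residual.GaloisImage

end
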